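import Summits.ValiantsHypothesis.ValiantsHypothesis.Theorems.DivisionGapPerDivisionHardStubPairFlipArith

/-!
# Crux `DivisionGap.PerDivisionHard` (stmt-ValiantsHypothesis-5065), line `pair-descent-jss-endpoint` —
stub `stub_pairFlip`, part 3: the two flip penalties

Third helper file of the PAIR-FLIP branch: from the indifference penalty `q₁` the two three-level
penalties `q^± = M²·q₁ + M·𝟙_{e^±} + g` and a common bound `W` (`exists_flipPens`): both weights
`W − q^±` cut out the face, `β₀` is decided oppositely, strict `q₁`-decisions persist, and equal
penalties force agreement off the face.
-/

noncomputable section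

-- `Summit.ValiantsHypothesis.ValiantsHypothesis.…` is the tree's mandated single-conjunct layout
-- (Sub = Summit), so the duplicated namespace component is intended.
set_option linter.dupNamespace false

namespace Summit.ValiantsHypothesis.ValiantsHypothesis.Theorems.DivisionGapPerDivisionHard

open MvPolynomial Literature.Computability.AlgebraicComplexity
open Summit.ValiantsHypothesis.ValiantsHypothesis.Theorems.ZeroOneTransfer.Negative
open scoped NNReal

namespace PairFlip

variable {n : ℕ}

/-- Registered sub-goal form of `levels_neg`. [folklore] -/
theorem pairFlip_levels_neg :
    ∀ (M u v z : ℤ), |v| + |z| < M → u < 0 → M ^ 2 * u + M * v + z < 0 :=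
  fun _ _ _ _ hM hu => levels_neg hM hu

/-! ### The two three-level penalties -/

/-- **The flip penalties.**  From the indifference penalty `q₁` build `q^± = M²·q₁ + M·𝟙_{e^±} + g`
and a common bound `W`: both weights `W − q^±` cut out `G`; `β₀` is decided oppositely (`s'` under
`q⁺`, `s` under `q⁻`); every strict `q₁`-decision between monomials with entries and degrees `≤ D`
persists under `q^±` (dominance); and equal `q^±`-penalties of two such monomials force agreement
off `G` (dominance + digit uniqueness). [folklore] -/
theorem exists_flipPens {n : ℕ} (G : Finset (Fin n × Fin n))
    (hPM : ∃ σ : Equiv.Perm (Fin n), ∀ i, (σ i, i) ∈ G) (s s' : (Fin n × Fin n) →₀ ℕ)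
    (ep em : Fin n × Fin n) {D B : ℕ} (g : Fin n × Fin n → ℕ)
    (hgdef : g = fun e => if e ∈ G then 0 else B ^ (finProdFinEquiv e : ℕ))
    (hB : B = 3 * (D * D) + D + 1)
    (hsdeg : s.degree ≤ D) (hs'deg : s'.degree ≤ D)
    (hep : ep ∉ G) (hem : em ∉ G) (hsep : s' ep < s ep) (hsem : s em < s' em)
    (q₁ : Fin n × Fin n → ℕ) (Q₁ : ℕ) (hq₁le : ∀ e, q₁ e ≤ Q₁) (hq₁G : ∀ e ∈ G, q₁ e = 0)
    (hindiff : ((∑ e, q₁ e * s e : ℕ) : ℤ) = ((∑ e, q₁ e * s' e : ℕ) : ℤ)) :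
    ∃ (qp qm : Fin n × Fin n → ℕ) (W : ℕ),
      CutsOut (fun e => W - qp e) G ∧ CutsOut (fun e => W - qm e) G ∧
      (∀ e, qp e ≤ W) ∧ (∀ e, qm e ≤ W) ∧
      (∑ e, qp e * s' e) < (∑ e, qp e * s e) ∧ (∑ e, qm e * s e) < (∑ e, qm e * s' e) ∧
      (∀ f f' : (Fin n × Fin n) →₀ ℕ, (∀ e, f e ≤ D) → (∀ e, f' e ≤ D) → f.degree ≤ D →
        f'.degree ≤ D → (∑ e, q₁ e * f e) < (∑ e, q₁ e * f' e) →
        (∑ e, qp e * f e) < (∑ e, qp e * f' e) ∧ (∑ e, qm e * f e) < (∑ e, qm e * f' e)) ∧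
      (∀ m₁ m₂ : (Fin n × Fin n) →₀ ℕ, (∀ e, m₁ e ≤ D) → (∀ e, m₂ e ≤ D) → m₁.degree ≤ D →
        m₂.degree ≤ D →
        ((∑ e, qp e * m₁ e) = (∑ e, qp e * m₂ e) → ∀ e ∉ G, m₁ e = m₂ e) ∧
        ((∑ e, qm e * m₁ e) = (∑ e, qm e * m₂ e) → ∀ e ∉ G, m₁ e = m₂ e)) := by
  classical
  have hB0 : 0 < B := by rw [hB]; omega
  have hDB : D < B := by rw [hB]; omega
  have hg_le : ∀ e, g e ≤ B ^ (n * n) := fun e => by rw [hgdef]; exact PairFlip.placePen_le G hB0 e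
  have hgG : ∀ e ∈ G, g e = 0 := fun e he => by rw [hgdef]; exact if_pos he
  have hgpos : ∀ e ∉ G, 0 < g e := fun e he => by rw [hgdef]; exact PairFlip.placePen_pos G hB0 he
  obtain ⟨Z, hZ⟩ : ∃ Z : ℕ, Z = B ^ (n * n) * D := ⟨_, rfl⟩
  have hpenZ : ∀ m : (Fin n × Fin n) →₀ ℕ, m.degree ≤ D → (∑ e, g e * m e) ≤ Z := fun m hm =>
    le_trans (PairFlip.pen_le g hg_le m) (by rw [hZ]; exact Nat.mul_le_mul_left _ hm)
  obtain ⟨dp, hdp⟩ : ∃ dp : ℕ, dp = s ep - s' ep := ⟨_, rfl⟩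
  obtain ⟨dm, hdm⟩ : ∃ dm : ℕ, dm = s' em - s em := ⟨_, rfl⟩
  have hdp0 : 0 < dp := by omega
  have hdm0 : 0 < dm := by omega
  have hdpZ : (dp : ℤ) = (s ep : ℤ) - s' ep := by omega
  have hdmZ : (dm : ℤ) = (s' em : ℤ) - s em := by omega
  obtain ⟨t, ht⟩ : ∃ t : ℤ, t = ((∑ e, g e * s e : ℕ) : ℤ) - ((∑ e, g e * s' e : ℕ) : ℤ) := ⟨_, rfl⟩
  have htZ : |t| ≤ Z := by
    have h1 : ((∑ e, g e * s e : ℕ) : ℤ) ≤ Z := by exact_mod_cast hpenZ s hsdeg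
    have h2 : ((∑ e, g e * s' e : ℕ) : ℤ) ≤ Z := by exact_mod_cast hpenZ s' hs'deg
    have h3 : (0 : ℤ) ≤ ((∑ e, g e * s e : ℕ) : ℤ) := Nat.cast_nonneg _
    have h4 : (0 : ℤ) ≤ ((∑ e, g e * s' e : ℕ) : ℤ) := Nat.cast_nonneg _
    rw [ht, abs_le]; constructor <;> linarith only [h1, h2, h3, h4]
  obtain ⟨M, hM⟩ : ∃ M : ℕ, M = D + Z + 1 := ⟨_, rfl⟩
  have hM1 : 1 ≤ M := by omega
  obtain ⟨qp, hqpdef⟩ : ∃ qp : Fin n × Fin n → ℕ,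
      qp = fun e => M ^ 2 * q₁ e + M * (if e = ep then 1 else 0) + g e := ⟨_, rfl⟩
  obtain ⟨qm, hqmdef⟩ : ∃ qm : Fin n × Fin n → ℕ,
      qm = fun e => M ^ 2 * q₁ e + M * (if e = em then 1 else 0) + g e := ⟨_, rfl⟩
  have hpenp : ∀ m : (Fin n × Fin n) →₀ ℕ,
      (∑ e, qp e * m e) = M ^ 2 * (∑ e, q₁ e * m e) + M * m ep + ∑ e, g e * m e :=
    fun m => by rw [hqpdef]; exact PairFlip.pen_levels q₁ g M ep m
  have hpenm : ∀ m : (Fin n × Fin n) →₀ ℕ,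
      (∑ e, qm e * m e) = M ^ 2 * (∑ e, q₁ e * m e) + M * m em + ∑ e, g e * m e :=
    fun m => by rw [hqmdef]; exact PairFlip.pen_levels q₁ g M em m
  -- a common upper bound `W`
  obtain ⟨W, hW⟩ : ∃ W : ℕ, W = M ^ 2 * Q₁ + M + B ^ (n * n) := ⟨_, rfl⟩
  have hWp : ∀ e, qp e ≤ W := by
    intro e
    simp only [hqpdef]
    have h1 : M ^ 2 * q₁ e ≤ M ^ 2 * Q₁ := Nat.mul_le_mul_left _ (hq₁le e)
    have h2 : M * (if e = ep then 1 else 0) ≤ M := by split_ifs <;> simp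
    have h3 := hg_le e
    rw [hW]; omega
  have hWm : ∀ e, qm e ≤ W := by
    intro e
    simp only [hqmdef]
    have h1 : M ^ 2 * q₁ e ≤ M ^ 2 * Q₁ := Nat.mul_le_mul_left _ (hq₁le e)
    have h2 : M * (if e = em then 1 else 0) ≤ M := by split_ifs <;> simp
    have h3 := hg_le e
    rw [hW]; omega
  -- vanishing on `G`, positivity off `G`
  have hqpG : ∀ e ∈ G, qp e = 0 := by
    intro e he
    have h1 : e ≠ ep := fun h => hep (h ▸ he)
    simp only [hqpdef, hq₁G e he, hgG e he, if_neg h1]; ring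
  have hqmG : ∀ e ∈ G, qm e = 0 := by
    intro e he
    have h2 : e ≠ em := fun h => hem (h ▸ he)
    simp only [hqmdef, hq₁G e he, hgG e he, if_neg h2]; ring
  have hqppos : ∀ e ∉ G, 0 < qp e := fun e he => by
    have := hgpos e he; simp only [hqpdef]; omega
  have hqmpos : ∀ e ∉ G, 0 < qm e := fun e he => by
    have := hgpos e he; simp only [hqmdef]; omega
  have hcutp : CutsOut (fun e => W - qp e) G := PairFlip.cutsOut_sub_pen n G qp W hWp hqpG hqppos hPM
  have hcutm : CutsOut (fun e => W - qm e) G := PairFlip.cutsOut_sub_pen n G qm W hWm hqmG hqmpos hPM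
  /- ### decisions -/
  -- the dominance hypothesis `|v| + |z| < M` for entries `≤ D` and place penalties `≤ Z`
  have hdom : ∀ (x y : (Fin n × Fin n) →₀ ℕ) (e₀ : Fin n × Fin n), (∀ e, x e ≤ D) → (∀ e, y e ≤ D) →
      x.degree ≤ D → y.degree ≤ D →
      |((x e₀ : ℤ) - y e₀)| + |(((∑ e, g e * x e : ℕ) : ℤ) - ((∑ e, g e * y e : ℕ) : ℤ))| < M := by
    intro x y e₀ hx hy hxd hyd
    have h1 : |((x e₀ : ℤ) - y e₀)| ≤ D := by
      have a1 : ((x e₀ : ℕ) : ℤ) ≤ D := by exact_mod_cast hx e₀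
      have a2 : ((y e₀ : ℕ) : ℤ) ≤ D := by exact_mod_cast hy e₀
      have a3 : (0 : ℤ) ≤ x e₀ := Nat.cast_nonneg _
      have a4 : (0 : ℤ) ≤ y e₀ := Nat.cast_nonneg _
      rw [abs_le]; constructor <;> linarith only [a1, a2, a3, a4]
    have h2 : |(((∑ e, g e * x e : ℕ) : ℤ) - ((∑ e, g e * y e : ℕ) : ℤ))| ≤ Z := by
      have h3 : ((∑ e, g e * x e : ℕ) : ℤ) ≤ Z := by exact_mod_cast hpenZ x hxd
      have h4 : ((∑ e, g e * y e : ℕ) : ℤ) ≤ Z := by exact_mod_cast hpenZ y hyd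
      have h5 : (0 : ℤ) ≤ ((∑ e, g e * x e : ℕ) : ℤ) := Nat.cast_nonneg _
      have h6 : (0 : ℤ) ≤ ((∑ e, g e * y e : ℕ) : ℤ) := Nat.cast_nonneg _
      rw [abs_le]; constructor <;> linarith only [h3, h4, h5, h6]
    have h7 : (M : ℤ) = D + Z + 1 := by rw [hM]; push_cast; ring
    linarith only [h1, h2, h7]
  -- `β₀`: `s'` wins under `qp`, `s` wins under `qm`
  have hMZ : (Z : ℤ) < M := by rw [hM]; push_cast; linarith only
  have hM0 : (0 : ℤ) ≤ M := Nat.cast_nonneg _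
  have hdec₀p : (∑ e, qp e * s' e) < ∑ e, qp e * s e := by
    have h1 : ((∑ e, qp e * s e : ℕ) : ℤ) - ((∑ e, qp e * s' e : ℕ) : ℤ) = M * dp + t := by
      rw [hpenp s, hpenp s', ht]; simp only [Nat.cast_add, Nat.cast_mul, Nat.cast_pow]
      linear_combination (M : ℤ) ^ 2 * hindiff - (M : ℤ) * hdpZ
    have h2 : (M : ℤ) * dp + t > 0 := by
      have h3 : (1 : ℤ) ≤ dp := by exact_mod_cast hdp0
      have h4 : (M : ℤ) ≤ (M : ℤ) * dp := by nlinarith only [h3, hM0]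
      have h5 := abs_le.mp htZ
      linarith only [h4, h5.1, hMZ]
    have h6 : ((∑ e, qp e * s' e : ℕ) : ℤ) < ((∑ e, qp e * s e : ℕ) : ℤ) := by linarith only [h1, h2]
    exact_mod_cast h6
  have hdec₀m : (∑ e, qm e * s e) < ∑ e, qm e * s' e := by
    have h1 : ((∑ e, qm e * s e : ℕ) : ℤ) - ((∑ e, qm e * s' e : ℕ) : ℤ) = -(M * dm) + t := by
      rw [hpenm s, hpenm s', ht]; simp only [Nat.cast_add, Nat.cast_mul, Nat.cast_pow]
      linear_combination (M : ℤ) ^ 2 * hindiff + (M : ℤ) * hdmZ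
    have h2 : -((M : ℤ) * dm) + t < 0 := by
      have h3 : (1 : ℤ) ≤ dm := by exact_mod_cast hdm0
      have h4 : (M : ℤ) ≤ (M : ℤ) * dm := by nlinarith only [h3, hM0]
      have h5 := abs_le.mp htZ
      linarith only [h4, h5.2, hMZ]
    have h6 : ((∑ e, qm e * s e : ℕ) : ℤ) < ((∑ e, qm e * s' e : ℕ) : ℤ) := by linarith only [h1, h2]
    exact_mod_cast h6
  -- strict `q₁`-decisions persist under `qp` and `qm`
  have hdec : ∀ f f' : (Fin n × Fin n) →₀ ℕ, (∀ e, f e ≤ D) → (∀ e, f' e ≤ D) → f.degree ≤ D →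
      f'.degree ≤ D → (∑ e, q₁ e * f e) < (∑ e, q₁ e * f' e) →
      (∑ e, qp e * f e) < (∑ e, qp e * f' e) ∧ (∑ e, qm e * f e) < (∑ e, qm e * f' e) := by
    intro f f' hfD hf'D hfd hf'd hlt
    have hlt' : ((∑ e, q₁ e * f e : ℕ) : ℤ) < ((∑ e, q₁ e * f' e : ℕ) : ℤ) := by exact_mod_cast hlt
    constructor
    · have key := PairFlip.levels_neg (hdom f f' ep hfD hf'D hfd hf'd)
        (u := ((∑ e, q₁ e * f e : ℕ) : ℤ) - ((∑ e, q₁ e * f' e : ℕ) : ℤ)) (by linarith only [hlt'])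
      have h1 : ((∑ e, qp e * f e : ℕ) : ℤ) - ((∑ e, qp e * f' e : ℕ) : ℤ) =
          (M : ℤ) ^ 2 * (((∑ e, q₁ e * f e : ℕ) : ℤ) - ((∑ e, q₁ e * f' e : ℕ) : ℤ)) +
            M * ((f ep : ℤ) - f' ep) + (((∑ e, g e * f e : ℕ) : ℤ) - ((∑ e, g e * f' e : ℕ) : ℤ)) := by
        rw [hpenp f, hpenp f']; simp only [Nat.cast_add, Nat.cast_mul, Nat.cast_pow]; ring
      have h2 : ((∑ e, qp e * f e : ℕ) : ℤ) < ((∑ e, qp e * f' e : ℕ) : ℤ) := by linarith only [key, h1]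
      exact_mod_cast h2
    · have key := PairFlip.levels_neg (hdom f f' em hfD hf'D hfd hf'd)
        (u := ((∑ e, q₁ e * f e : ℕ) : ℤ) - ((∑ e, q₁ e * f' e : ℕ) : ℤ)) (by linarith only [hlt'])
      have h1 : ((∑ e, qm e * f e : ℕ) : ℤ) - ((∑ e, qm e * f' e : ℕ) : ℤ) =
          (M : ℤ) ^ 2 * (((∑ e, q₁ e * f e : ℕ) : ℤ) - ((∑ e, q₁ e * f' e : ℕ) : ℤ)) +
            M * ((f em : ℤ) - f' em) + (((∑ e, g e * f e : ℕ) : ℤ) - ((∑ e, g e * f' e : ℕ) : ℤ)) := by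
        rw [hpenm f, hpenm f']; simp only [Nat.cast_add, Nat.cast_mul, Nat.cast_pow]; ring
      have h2 : ((∑ e, qm e * f e : ℕ) : ℤ) < ((∑ e, qm e * f' e : ℕ) : ℤ) := by linarith only [key, h1]
      exact_mod_cast h2
  -- genericity: equal penalty under `qp` (or `qm`) forces agreement off `G`
  have hgen : ∀ m₁ m₂ : (Fin n × Fin n) →₀ ℕ, (∀ e, m₁ e ≤ D) → (∀ e, m₂ e ≤ D) → m₁.degree ≤ D →
      m₂.degree ≤ D →
      ((∑ e, qp e * m₁ e) = (∑ e, qp e * m₂ e) → ∀ e ∉ G, m₁ e = m₂ e) ∧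
      ((∑ e, qm e * m₁ e) = (∑ e, qm e * m₂ e) → ∀ e ∉ G, m₁ e = m₂ e) := by
    intro m₁ m₂ hm₁ hm₂ hm₁d hm₂d
    constructor
    · intro heq
      have h1 : (M : ℤ) ^ 2 * (((∑ e, q₁ e * m₁ e : ℕ) : ℤ) - ((∑ e, q₁ e * m₂ e : ℕ) : ℤ)) +
          M * ((m₁ ep : ℤ) - m₂ ep) + (((∑ e, g e * m₁ e : ℕ) : ℤ) - ((∑ e, g e * m₂ e : ℕ) : ℤ)) = 0 := by
        have : ((∑ e, qp e * m₁ e : ℕ) : ℤ) = ((∑ e, qp e * m₂ e : ℕ) : ℤ) := by exact_mod_cast heq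
        rw [hpenp m₁, hpenp m₂] at this; simp only [Nat.cast_add, Nat.cast_mul, Nat.cast_pow] at this
        linear_combination this
      obtain ⟨-, -, hz⟩ := PairFlip.eq_zero_of_levels (hdom m₁ m₂ ep hm₁ hm₂ hm₁d hm₂d) h1
      exact PairFlip.eq_offG_of_pen_eq G g hgdef (fun e => lt_of_le_of_lt (hm₁ e) hDB)
        (fun e => lt_of_le_of_lt (hm₂ e) hDB) (by exact_mod_cast (sub_eq_zero.mp hz))
    · intro heq
      have h1 : (M : ℤ) ^ 2 * (((∑ e, q₁ e * m₁ e : ℕ) : ℤ) - ((∑ e, q₁ e * m₂ e : ℕ) : ℤ)) +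
          M * ((m₁ em : ℤ) - m₂ em) + (((∑ e, g e * m₁ e : ℕ) : ℤ) - ((∑ e, g e * m₂ e : ℕ) : ℤ)) = 0 := by
        have : ((∑ e, qm e * m₁ e : ℕ) : ℤ) = ((∑ e, qm e * m₂ e : ℕ) : ℤ) := by exact_mod_cast heq
        rw [hpenm m₁, hpenm m₂] at this; simp only [Nat.cast_add, Nat.cast_mul, Nat.cast_pow] at this
        linear_combination this
      obtain ⟨-, -, hz⟩ := PairFlip.eq_zero_of_levels (hdom m₁ m₂ em hm₁ hm₂ hm₁d hm₂d) h1
      exact PairFlip.eq_offG_of_pen_eq G g hgdef (fun e => lt_of_le_of_lt (hm₁ e) hDB)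
        (fun e => lt_of_le_of_lt (hm₂ e) hDB) (by exact_mod_cast (sub_eq_zero.mp hz))
  exact ⟨qp, qm, W, hcutp, hcutm, hWp, hWm, hdec₀p, hdec₀m, hdec, hgen⟩

end PairFlip

end Summit.ValiantsHypothesis.ValiantsHypothesis.Theorems.DivisionGapPerDivisionHard

end
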